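import Literature.Combinatorics.Digraph.IteratedLineDigraph
import Literature.Combinatorics.Digraph.DeBruijnGraphSpectrum
import HarnessLib

/-!
# `DB_n = Lⁿ(DB_0)` and `κ(DB_n) = 2^{2^n − 1}` from Levine's Theorem 4.1

Topic `Literature/Combinatorics/Digraph`, namespace `Literature.Combinatorics.Digraph.Multidigraph`.
Lane `lit-hodgefound`, seat p23, generation 46, row g46-#16 of the programme «The spectrum of the arc
digraph and de Bruijn's count `2^{2^{n−1}−n}`» (the de Bruijn instance of `IteratedLineDigraph`).

## Source, verbatim

L. Levine, *Sandpile groups and spanning trees of directed line graphs*, J. Combin. Theory Ser. A 118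
(2011) 350–364 [Levine2011], §4 (held text `paper:arxiv-0906.2809`, chunk p0010):
«For example, the de Bruijn graph `DB_n` is `Lⁿ(DB_0)`, where `DB_0` is the graph with one vertex and
two loops. […] When `G` is balanced `k`-regular, we have `p(n, v) = kⁿ` for all vertices `v`, so we obtain
as a special case of Theorem 4.1 the result of Huaxiao, Fuji and Qiongxiang `κ(Lⁿ G) = κ(G) k^{(kⁿ−1)#V}`.
In particular, taking `G = DB_0` yields the classical formula `κ(DB_n) = 2^{2^n − 1}`. Since `DB_n` is
Eulerian, the number `κ(DB_n, v_*)` of oriented spanning trees rooted at `v_*` does not depend on `v_*`, so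
`κ(DB_n, v_*) = 2^{−n} κ(DB_n) = 2^{2^n − n − 1}`.»

## What is here (definitions with bodies, theorems; no named fact, no instance, no notation)

* `pathDeBruijnVertexEquiv`, `pathDeBruijnArcEquiv`, **`pathDeBruijnIso k : Lᵏ⁺¹(DB_0) ≅ DB_{k+1}`** —
  «`DB_n = Lⁿ(DB_0)`»: a path of `k + 1` loops of `DB_0 = deBruijnGraph 0` is the binary word of its
  `k + 1` letters (the tree's `deBruijnGraph (k+1)`, whose vertices are the `(k+1)`-letter words).
* **`sum_card_arborescencesTo_deBruijnGraph_succ`** — «taking `G = DB_0` yields the classical formula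
  `κ(DB_n) = 2^{2^n − 1}`» (`n = k + 1`), from Theorem 4.1 (`sum_card_arborescencesTo_pathDigraph_of_regular`
  with `k = 2`, `#V = 1`, `κ(DB_0) = 1`); `sum_card_arborescencesTo_deBruijnGraph` — the same for every `n`
  directly from `DeBruijnGraphSpectrum` (`2^n` roots, each with `2^{2^n − n − 1}` trees), as a cross-check.

## References

* [Levine2011] L. Levine, *Sandpile groups and spanning trees of directed line graphs*, J. Combin.
  Theory Ser. A 118 (2011) 350–364, §4.
* Tree: `Digraph/IteratedLineDigraph` (`pathDigraph`, `sum_card_arborescencesTo_pathDigraph_of_regular`),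
  `Digraph/DeBruijnGraph` (`deBruijnGraph`, `inDeg_deBruijnGraph`, `outDeg_deBruijnGraph`),
  `Digraph/DeBruijnGraphSpectrum` (`card_arborescencesTo_deBruijnGraph`),
  `Digraph/MultidigraphAdjacencyMatrix` (`Iso.card_arborescencesTo_eq`).
-/

namespace Literature.Combinatorics.Digraph

namespace Multidigraph

open Finset

/-! ### §1 `DB_{k+1} ≅ L^{k+1}(DB_0)` -/

section Iso

/-- A path of `k + 1` loops of `DB_0` (each loop a one-letter word) is the `(k+1)`-letter word of its
letters. [cite: Levine2011, §4 («the de Bruijn graph `DB_n` is `Lⁿ(DB_0)`»)] -/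
def pathDeBruijnVertexEquiv (k : ℕ) :
    {p : Fin (k + 1) → (Fin 1 → Bool) // (deBruijnGraph 0).IsPath p} ≃ (Fin (k + 1) → Bool) where
  toFun p := fun i => p.1 i 0
  invFun w := ⟨fun i _ => w i, fun _ => Subsingleton.elim _ _⟩
  left_inv p := Subtype.ext (funext fun i => funext fun j => by
    show p.1 i 0 = p.1 i j
    rw [Subsingleton.elim j 0])
  right_inv _ := rfl

/-- The same one level up, for the arcs. [cite: Levine2011, §4] -/
def pathDeBruijnArcEquiv (k : ℕ) :
    {q : Fin (k + 2) → (Fin 1 → Bool) // (deBruijnGraph 0).IsPath q} ≃ (Fin (k + 2) → Bool) :=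
  pathDeBruijnVertexEquiv (k + 1)

/-- **`L^{k+1}(DB_0) ≅ DB_{k+1}`** («the de Bruijn graph `DB_n` is `Lⁿ(DB_0)`, where `DB_0` is the graph
with one vertex and two loops»): letters of the loops along the path; sources and targets (dropping the
last ∕ the first loop, resp. letter) correspond definitionally. [cite: Levine2011, §4] -/
def pathDeBruijnIso (k : ℕ) : Iso ((deBruijnGraph 0).pathDigraph k) (deBruijnGraph (k + 1)) where
  vertexEquiv := pathDeBruijnVertexEquiv k
  arcEquiv := pathDeBruijnArcEquiv k
  src_comm _ := rfl
  tgt_comm _ := rfl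

end Iso

/-! ### §2 `κ(DB_n) = 2^{2^n − 1}` -/

section Count

/-- **«Taking `G = DB_0` yields the classical formula `κ(DB_n) = 2^{2^n − 1}`»** (`n = k + 1`): Theorem
4.1 in its `2`-regular form for `DB_0` (`#V = 1`, `κ(DB_0) = 1`), transported along
`L^{k+1}(DB_0) ≅ DB_{k+1}`; here `κ(DB_n) = Σ_{v_*} κ(DB_n, v_*)` sums the oriented spanning trees over
all roots. [cite: Levine2011, §4 (after Thm. 4.1)] -/
theorem sum_card_arborescencesTo_deBruijnGraph_succ (k : ℕ) :
    ∑ w, ((deBruijnGraph (k + 1)).arborescencesTo w).card = 2 ^ (2 ^ (k + 1) - 1) := by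
  have hiso : ∑ w, ((deBruijnGraph (k + 1)).arborescencesTo w).card =
      ∑ p, (((deBruijnGraph 0).pathDigraph k).arborescencesTo p).card := by
    rw [← (pathDeBruijnVertexEquiv k).sum_comp]
    exact Finset.sum_congr rfl fun p _ => (pathDeBruijnIso k).card_arborescencesTo_eq p
  rw [hiso, (deBruijnGraph 0).sum_card_arborescencesTo_pathDigraph_of_regular two_pos
    (inDeg_deBruijnGraph 0) (outDeg_deBruijnGraph 0) k,
    Fintype.sum_subsingleton _ (default : Fin 0 → Bool), card_arborescencesTo_deBruijnGraph]
  simp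

/-- The same number for every `n`, read off `DeBruijnGraphSpectrum` directly: `2^n` roots, each with
`κ(DB_n, v_*) = 2^{2^n − n − 1}` oriented spanning trees («`κ(DB_n, v_*) = 2^{−n} κ(DB_n) = 2^{2^n − n − 1}`»).
[cite: Levine2011, §4 (after Thm. 4.1)] -/
theorem sum_card_arborescencesTo_deBruijnGraph (n : ℕ) :
    ∑ w, ((deBruijnGraph n).arborescencesTo w).card = 2 ^ (2 ^ n - 1) := by
  simp_rw [card_arborescencesTo_deBruijnGraph]
  rw [Finset.sum_const, Finset.card_univ, smul_eq_mul, Fintype.card_fun, Fintype.card_fin,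
    Fintype.card_bool, ← pow_add]
  congr 1
  have h : n + 1 ≤ 2 ^ n := Nat.lt_two_pow_self
  omega

end Count

end Multidigraph

end Literature.Combinatorics.Digraph
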